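import Summits.Ventures.CertifiedManyBodySolver.Rows.HalfFilledTLTorusPin
import HarnessLib

/-!
# M2 rows, part 12 — block pins by exclusion INSIDE a ground-state envelope

HONEST FRAMING: first certified bounds; not a superconductivity verdict; every number certified or
labelled float.  This file contains NO number of physics: it is typed vocabulary (edges) only.

## Why this file
Part 7 (`Rows/HalfFilledTLTorusPin.lean`) pins a block `K` of the even `L × L` torus at `U > 0` by
EXCLUSION (`TorusBlockPinRow.of_exclusion`): cover the WHOLE central sector, `szSector (L²) 0 ≤ K ⊔ K'`,
with `K'` an orthogonal `H`-invariant block carrying a form floor `τ > E₀(L²)`.  AS TYPED that asks for a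
floor on every complementary block.  The certified 4 × 4 pins (pub-mbboot IMPORT.md v1.7 §B.9; adv-2,
2026-08-21T03:43:59Z, remark Q-v1.7) carry floors only on `K₄ ⊖ K(1)`, where
`K₄ = ⊕_{χ' ∈ {1, ε, δ, εδ}} K(χ')` is the part of the central sector allowed by TREE THEOREMS about THE
ground state (total spin `S = 0`, `η ψ = 0`, one-dimensional `B₄`-character); no floor exists — and none
is needed — on the `S ≥ 1` / `η ≠ 0` / higher-dimensional-character parts.

This file types exactly that reading.  A GROUND-STATE ENVELOPE (`IsGSEnvelope L U M`) is a subspace `M`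
containing every half-filled ground state of the central sector; envelopes intersect (`IsGSEnvelope.inf`)
and are monotone (`IsGSEnvelope.mono`), and the whole sector is one (`isGSEnvelope_szSector`).  The pin by
exclusion then needs the cover and the floor only INSIDE an envelope:
`TorusBlockPinRow.of_exclusion_gs` (cover stated on ground states directly),
`TorusBlockPinRow.of_exclusion_envelope` (`M ≤ K ⊔ K'`), and their table forms `…_upperRow` (the strict
inequality `E₀ < τ` discharged by a certified ceiling `TorusEnergyUpperRow L U hi` and `hi < τ : ℚ`).
Part 7's `of_exclusion` is the special case `M = szSector (L²) 0` (`of_exclusion_gs` with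
`isGSEnvelope_szSector`).  The proofs are part 7's, verbatim, with the one changed line.

Nothing here is specific to `L = 4`; the envelope facts (`S = 0`, `η ψ = 0`, characters) and the
blocks / floors are supplied by the instance writer (tree theorems resp. `[X]`/`[F]` claim nodes), exactly
as in part 7.  References: Lieb, PRL 62 (1989) 1201, Thm 2 (uniqueness, `S = 0`); Lieb–Wu, Physica A 321
(2003) 1, §2; Tasaki (2020) §2.1–2.2 (variational characterisation of block minima).
-/

noncomputable section

namespace Summit.Ventures.CertifiedManyBodySolver

open Literature.MathematicalPhysics.QuantumLattice
open Matrix HubbardWave0 Literature.Probability.LatticeModels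

namespace M2

variable {L : ℕ}

/-! ## §1 Ground-state envelopes -/

/-- **Ground-state envelope**: every half-filled (`N = L²`) ground state of
`H(U) = hamiltonian (fermionTorusGraph 2 L) 1 U` lying in the central sector `szSector (L²) 0` belongs to
`M`.  (On an even torus with `U > 0` THE ground state is unique and lies in that sector — Lieb — so this
is a statement about one vector; it is typed for all ground states so that no choice is involved.)
[cite: LiebPRL1989, Theorem 2] -/
def IsGSEnvelope (L : ℕ) (U : ℝ) (M : Submodule ℂ (Fock (Orb (FermionTorus 2 L)))) : Prop :=
  ∀ ψ ∈ szSector (Λ := FermionTorus 2 L) (L ^ 2) 0,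
    IsGroundState (hamiltonian (fermionTorusGraph 2 L) 1 U) (L ^ 2) ψ → ψ ∈ M

/-- The central sector itself is an envelope (this recovers part 7's `of_exclusion`).
[cite: LiebPRL1989, Theorem 2] -/
theorem isGSEnvelope_szSector (L : ℕ) (U : ℝ) :
    IsGSEnvelope L U (szSector (Λ := FermionTorus 2 L) (L ^ 2) 0) :=
  fun _ hψS _ => hψS

/-- Any subspace containing the central sector is an envelope. [cite: LiebPRL1989, Theorem 2] -/
theorem IsGSEnvelope.of_szSector_le {U : ℝ} {M : Submodule ℂ (Fock (Orb (FermionTorus 2 L)))}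
    (h : szSector (Λ := FermionTorus 2 L) (L ^ 2) 0 ≤ M) : IsGSEnvelope L U M :=
  fun _ hψS _ => h hψS

/-- Envelopes are upward closed. [cite: LiebPRL1989, Theorem 2] -/
theorem IsGSEnvelope.mono {U : ℝ} {M M' : Submodule ℂ (Fock (Orb (FermionTorus 2 L)))}
    (hM : IsGSEnvelope L U M) (hle : M ≤ M') : IsGSEnvelope L U M' :=
  fun ψ hψS hgs => hle (hM ψ hψS hgs)

/-- Envelopes intersect: e.g. (`S = 0`) ⊓ (`η ψ = 0`) ⊓ (one-dimensional `B₄`-character) is an envelope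
as soon as each factor is. [cite: LiebPRL1989, Theorem 2] -/
theorem IsGSEnvelope.inf {U : ℝ} {M₁ M₂ : Submodule ℂ (Fock (Orb (FermionTorus 2 L)))}
    (h₁ : IsGSEnvelope L U M₁) (h₂ : IsGSEnvelope L U M₂) : IsGSEnvelope L U (M₁ ⊓ M₂) :=
  fun ψ hψS hgs => Submodule.mem_inf.2 ⟨h₁ ψ hψS hgs, h₂ ψ hψS hgs⟩

/-- An envelope from an ANNIHILATION fact: if a linear map `A` kills every central-sector ground state
(e.g. `A = S⁻S⁺ + S_z(S_z + 1)` for `S = 0`, or `A = η` for `η ψ = 0`), then `ker A` is an envelope.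
[cite: LiebPRL1989, Theorem 2] -/
theorem IsGSEnvelope.of_mulVec_eq_zero {U : ℝ}
    {A : Matrix (Finset (Orb (FermionTorus 2 L))) (Finset (Orb (FermionTorus 2 L))) ℂ}
    (hA : ∀ ψ ∈ szSector (Λ := FermionTorus 2 L) (L ^ 2) 0,
      IsGroundState (hamiltonian (fermionTorusGraph 2 L) 1 U) (L ^ 2) ψ → A *ᵥ ψ = 0) :
    IsGSEnvelope L U (LinearMap.ker (Matrix.toLin' A)) :=
  fun ψ hψS hgs => by
    rw [LinearMap.mem_ker, Matrix.toLin'_apply]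
    exact hA ψ hψS hgs

/-! ## §2 Pin by exclusion inside an envelope -/

/-- **Pin by exclusion, ground-state-relative cover** (even torus, `U > 0`).  As part 7's
`TorusBlockPinRow.of_exclusion`, but the cover `ψ ∈ K ⊔ K'` is required only of central-sector GROUND
STATES `ψ` (not of the whole sector), and the form floor `≥ τ‖·‖²` with `E₀(L²) < τ` only on `K'`.
Then THE ground state (Lieb) lies in `K` and `minEnergyOn (H U) K = E₀(L²)`.
[cite: LiebPRL1989, Theorem 2] [cite: Tasaki2020, §2.1] -/
theorem TorusBlockPinRow.of_exclusion_gs [NeZero L] (hL : Even L) {U : ℝ} (hU : 0 < U)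
    {K K' : Submodule ℂ (Fock (Orb (FermionTorus 2 L)))}
    (hKN : K ≤ nParticleSubmodule (L ^ 2))
    (hKH : ∀ v ∈ K, hamiltonian (fermionTorusGraph 2 L) 1 U *ᵥ v ∈ K)
    (hK'H : ∀ v ∈ K', hamiltonian (fermionTorusGraph 2 L) 1 U *ᵥ v ∈ K')
    (horth : ∀ y ∈ K, ∀ z ∈ K', star y ⬝ᵥ z = 0)
    (hcover : ∀ ψ ∈ szSector (Λ := FermionTorus 2 L) (L ^ 2) 0,
      IsGroundState (hamiltonian (fermionTorusGraph 2 L) 1 U) (L ^ 2) ψ → ψ ∈ K ⊔ K')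
    {τ : ℝ} (hfloor : ∀ z ∈ K', τ * (star z ⬝ᵥ z).re ≤
      (star z ⬝ᵥ hamiltonian (fermionTorusGraph 2 L) 1 U *ᵥ z).re)
    (hτ : groundEnergyAt (fermionTorusGraph 2 L) 1 U (L ^ 2) < τ) :
    TorusBlockPinRow L U K := by
  set H := hamiltonian (fermionTorusGraph 2 L) 1 U with hH
  set E₀ : ℝ := groundEnergyAt (fermionTorusGraph 2 L) 1 U (L ^ 2) with hE₀
  obtain ⟨ψ, hψS, hψ1, hHψ, -⟩ :=
    LiebHalfFilled.hubbardTorus_exists_unit_groundState_pow (d := 2) (L := L) two_pos hL one_ne_zero hU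
  have hψN : IsNParticle (L ^ 2) ψ := ((mem_szSector_iff _ _ _).1 hψS).1
  have hψ0 : ψ ≠ 0 := by
    rintro rfl
    rw [star_zero, zero_dotProduct] at hψ1
    exact zero_ne_one hψ1
  have hgs : IsGroundState H (L ^ 2) ψ := ⟨hψN, hψ0, hHψ⟩
  -- decompose THE ground state along `K ⊔ K'` (the cover is asked of ground states only)
  obtain ⟨y, hy, z, hz, hyz⟩ := Submodule.mem_sup.1 (hcover ψ hψS hgs)
  -- `⟨z, H ψ⟩ = ⟨z, H z⟩` and `⟨z, ψ⟩ = ⟨z, z⟩`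
  have hzy : star z ⬝ᵥ y = 0 := by
    rw [← star_star (star z ⬝ᵥ y), star_dotProduct, star_star, horth y hy z hz, star_zero]
  have hzHy : star z ⬝ᵥ H *ᵥ y = 0 :=
    star_dotProduct_hamiltonian_mulVec_eq_zero (fermionTorusGraph 2 L) 1 U hK'H horth hy hz
  have hzz : star z ⬝ᵥ H *ᵥ z = (E₀ : ℂ) * (star z ⬝ᵥ z) := by
    have h1 : star z ⬝ᵥ H *ᵥ ψ = (E₀ : ℂ) * (star z ⬝ᵥ ψ) := by
      rw [hHψ, dotProduct_smul, smul_eq_mul]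
    rw [← hyz, mulVec_add, dotProduct_add, dotProduct_add, hzHy, hzy, zero_add, zero_add] at h1
    exact h1
  -- hence `z = 0`
  have hz0 : z = 0 := by
    by_contra hz0
    have hpos := EigenvalueContinuation.re_star_dotProduct_self_pos hz0
    have hf := hfloor z hz
    rw [hzz, Complex.re_ofReal_mul] at hf
    have : τ ≤ E₀ := le_of_mul_le_mul_right hf hpos
    exact absurd hτ (not_lt.2 this)
  rw [hz0, add_zero] at hyz
  rw [← hyz] at hψN hψ0 hHψ
  exact TorusBlockPinRow.of_groundState_mem hKN hKH ⟨hψN, hψ0, hHψ⟩ hy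

/-- **Pin by exclusion inside an envelope** (even torus, `U > 0`): if every central-sector ground state
lies in `M` (`IsGSEnvelope L U M` — tree theorems: `S = 0`, `η ψ = 0`, characters, …), `M ≤ K ⊔ K'` with
`K` an `H`-invariant block of `L²`-particle states, `K'` an orthogonal `H`-invariant block whose form is
`≥ τ‖·‖²`, and `E₀(L²) < τ`, then `minEnergyOn (H U) K = E₀(L²)`.  (This is the reading of the certified
4 × 4 pins: `M = K₄`, `K = K(1)`, `K' = K(ε) ⊕ K(δ) ⊕ K(εδ)` with floors combined by `blockFloor_sup`.)
[cite: LiebPRL1989, Theorem 2] [cite: Tasaki2020, §2.1] -/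
theorem TorusBlockPinRow.of_exclusion_envelope [NeZero L] (hL : Even L) {U : ℝ} (hU : 0 < U)
    {M K K' : Submodule ℂ (Fock (Orb (FermionTorus 2 L)))} (hM : IsGSEnvelope L U M)
    (hMcover : M ≤ K ⊔ K')
    (hKN : K ≤ nParticleSubmodule (L ^ 2))
    (hKH : ∀ v ∈ K, hamiltonian (fermionTorusGraph 2 L) 1 U *ᵥ v ∈ K)
    (hK'H : ∀ v ∈ K', hamiltonian (fermionTorusGraph 2 L) 1 U *ᵥ v ∈ K')
    (horth : ∀ y ∈ K, ∀ z ∈ K', star y ⬝ᵥ z = 0)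
    {τ : ℝ} (hfloor : ∀ z ∈ K', τ * (star z ⬝ᵥ z).re ≤
      (star z ⬝ᵥ hamiltonian (fermionTorusGraph 2 L) 1 U *ᵥ z).re)
    (hτ : groundEnergyAt (fermionTorusGraph 2 L) 1 U (L ^ 2) < τ) :
    TorusBlockPinRow L U K :=
  TorusBlockPinRow.of_exclusion_gs hL hU hKN hKH hK'H horth
    (fun ψ hψS hgs => hMcover (hM ψ hψS hgs)) hfloor hτ

/-- **Table form of `of_exclusion_gs`**: `E₀(L²) < τ` discharged by a certified ceiling
`TorusEnergyUpperRow L U hi` (e.g. `TorusEnergyUpperRow.of_trial`) and the rational comparison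
`hi < τ`. [cite: LiebPRL1989, Theorem 2] -/
theorem TorusBlockPinRow.of_exclusion_gs_upperRow [NeZero L] (hL : Even L) {U : ℝ} (hU : 0 < U)
    {K K' : Submodule ℂ (Fock (Orb (FermionTorus 2 L)))}
    (hKN : K ≤ nParticleSubmodule (L ^ 2))
    (hKH : ∀ v ∈ K, hamiltonian (fermionTorusGraph 2 L) 1 U *ᵥ v ∈ K)
    (hK'H : ∀ v ∈ K', hamiltonian (fermionTorusGraph 2 L) 1 U *ᵥ v ∈ K')
    (horth : ∀ y ∈ K, ∀ z ∈ K', star y ⬝ᵥ z = 0)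
    (hcover : ∀ ψ ∈ szSector (Λ := FermionTorus 2 L) (L ^ 2) 0,
      IsGroundState (hamiltonian (fermionTorusGraph 2 L) 1 U) (L ^ 2) ψ → ψ ∈ K ⊔ K')
    {τ : ℚ} (hfloor : ∀ z ∈ K', ((τ : ℚ) : ℝ) * (star z ⬝ᵥ z).re ≤
      (star z ⬝ᵥ hamiltonian (fermionTorusGraph 2 L) 1 U *ᵥ z).re)
    {hi : ℚ} (hup : TorusEnergyUpperRow L U hi) (hτ : hi < τ) :
    TorusBlockPinRow L U K :=
  TorusBlockPinRow.of_exclusion_gs hL hU hKN hKH hK'H horth hcover hfloor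
    (lt_of_le_of_lt hup (by exact_mod_cast hτ))

/-- **Table form of `of_exclusion_envelope`**: `E₀(L²) < τ` discharged by a certified ceiling
`TorusEnergyUpperRow L U hi` and `hi < τ : ℚ`.  This is the signature an instance of the certified 4 × 4
character pins fills: `hM` from the tree (`S = 0`, `η ψ = 0`, 1-dim `B₄`-character ⇒ `ψ ∈ K₄`),
`hMcover : K₄ ≤ K(1) ⊔ K'`, `hfloor` the `[F]` PD floors on `K' = K(ε) ⊕ K(δ) ⊕ K(εδ)` (`blockFloor_sup`),
`hup` the `[X]` trial ceiling. [cite: LiebPRL1989, Theorem 2] -/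
theorem TorusBlockPinRow.of_exclusion_envelope_upperRow [NeZero L] (hL : Even L) {U : ℝ} (hU : 0 < U)
    {M K K' : Submodule ℂ (Fock (Orb (FermionTorus 2 L)))} (hM : IsGSEnvelope L U M)
    (hMcover : M ≤ K ⊔ K')
    (hKN : K ≤ nParticleSubmodule (L ^ 2))
    (hKH : ∀ v ∈ K, hamiltonian (fermionTorusGraph 2 L) 1 U *ᵥ v ∈ K)
    (hK'H : ∀ v ∈ K', hamiltonian (fermionTorusGraph 2 L) 1 U *ᵥ v ∈ K')
    (horth : ∀ y ∈ K, ∀ z ∈ K', star y ⬝ᵥ z = 0)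
    {τ : ℚ} (hfloor : ∀ z ∈ K', ((τ : ℚ) : ℝ) * (star z ⬝ᵥ z).re ≤
      (star z ⬝ᵥ hamiltonian (fermionTorusGraph 2 L) 1 U *ᵥ z).re)
    {hi : ℚ} (hup : TorusEnergyUpperRow L U hi) (hτ : hi < τ) :
    TorusBlockPinRow L U K :=
  TorusBlockPinRow.of_exclusion_envelope hL hU hM hMcover hKN hKH hK'H horth hfloor
    (lt_of_le_of_lt hup (by exact_mod_cast hτ))

/-- Consistency with part 7: the whole-sector cover is the envelope `szSector (L²) 0`, so
`of_exclusion` is `of_exclusion_envelope` with `isGSEnvelope_szSector`. [cite: LiebPRL1989, Theorem 2] -/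
theorem TorusBlockPinRow.of_exclusion_eq_envelope [NeZero L] (hL : Even L) {U : ℝ} (hU : 0 < U)
    {K K' : Submodule ℂ (Fock (Orb (FermionTorus 2 L)))}
    (hKN : K ≤ nParticleSubmodule (L ^ 2))
    (hKH : ∀ v ∈ K, hamiltonian (fermionTorusGraph 2 L) 1 U *ᵥ v ∈ K)
    (hK'H : ∀ v ∈ K', hamiltonian (fermionTorusGraph 2 L) 1 U *ᵥ v ∈ K')
    (horth : ∀ y ∈ K, ∀ z ∈ K', star y ⬝ᵥ z = 0)
    (hcover : szSector (Λ := FermionTorus 2 L) (L ^ 2) 0 ≤ K ⊔ K')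
    {τ : ℝ} (hfloor : ∀ z ∈ K', τ * (star z ⬝ᵥ z).re ≤
      (star z ⬝ᵥ hamiltonian (fermionTorusGraph 2 L) 1 U *ᵥ z).re)
    (hτ : groundEnergyAt (fermionTorusGraph 2 L) 1 U (L ^ 2) < τ) :
    TorusBlockPinRow L U K :=
  TorusBlockPinRow.of_exclusion_envelope hL hU (isGSEnvelope_szSector L U) hcover hKN hKH hK'H horth
    hfloor hτ

end M2

end Summit.Ventures.CertifiedManyBodySolver

end
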